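/-
Copyright (c) 2026 the pub-hodgecm-mathlib formalisation cell (harness21).  Prover seat hodgecm-mathlib-K2E3-p24 (g0), HCML Track B «K2-LIT» ∕ h413
(`stmt-HodgeConjecture-24833`), line `K2_E3_EllipticInputs`, road «GL₂-sc» (road owner K2E5-p17 (g5), dealer K2E3-plan (g4)), NON-ELLIPTIC half (lead K2E3-p23 (g6)),
brick 2N-6, FILE 3 OF 4: the `Fin 2` twin of ★ `K2E3GL3ModUniformizerLocIntTransfer` (K2E3-p17 (g7)) — «a weight `W` on `G' = GL₂(F) ⧸ ϖ^ℤ·1` dominated upstairs by a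
function locally integrable on the invertible matrices is locally integrable for every Haar measure of `G'`».  2026-09-04.
-/
import Summits.HodgeConjecture.HodgeConjecture.Theorems.K2E3HaarLocallyIntegrableTransport      -- ★ p858266 (K2E3-p17 (g7)): generic (b) `locallyIntegrable_comp_coe`, (c) `locallyIntegrable_of_locallyIntegrable_comp`
import Summits.HodgeConjecture.HodgeConjecture.Theorems.K2E3GL2SupercuspidalCharLocInt           -- ★ 2A-2 (K2E5-p17 (g5)): `eq_one_of_mem_glInt_of_mk_eq_one` (`GL₂(𝒪) ∩ ϖ^ℤ·1 = 1`); brings ★ (2F-a) `K2E3GL2ModCentre` frame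
import HarnessLib

/-!
# K2_E3 road (h413), road «GL₂-sc», brick 2N-6 (3∕4) — T15 transport at `G' = GL₂(F) ⧸ ϖ^ℤ·1`: local integrability of a weight on `G'` from a dominating function on `{X ∈ M₂(F) | IsUnit X}`

Cell `pub/hodgecm-mathlib` (D-0151), Track B, seat K2E3-p24 (g0) (hand on the NON-ELLIPTIC half of road «GL₂-sc», brick 2N-6 by name, K2E3-p23 (g6) 09:17:50Z ∕ K2E5-p17
(g5) HANDS PROTOCOL «each head := the named ★ `N = 3` theorem read at `Fin 2`»).  This file specialises ★ `K2E3HaarLocallyIntegrableTransport` to the road's quotient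
map `mk : GL₂(F) → G'` (continuous, open, surjective; injective on `GL₂(𝒪)` by ★ 2A-2 `eq_one_of_mem_glInt_of_mk_eq_one`).  `--supports stmt-HodgeConjecture-24833 --as helper`; THEOREMS ONLY (no definition ∕
instance ∕ notation ∕ named fact ∕ `sorry`); never imports `Cruxes/…/Lines`.  COUNT-NEUTRAL.

* §1 **`locallyIntegrable_of_locallyIntegrable_comp_mk`** — `W : G' → E` a.e.-strongly measurable for a Haar measure `μ'` of `G'`, `W ∘ mk` locally integrable for a
  Haar measure `ρ` of `GL₂(F)` ⟹ `W` locally `μ'`-integrable (★ (c) at `p = mk`, `V = GL₂(𝒪)`; `GL₂(𝒪) ∩ ϖ^ℤ·1 = 1` is ★ 2A-2 `eq_one_of_mem_glInt_of_mk_eq_one`).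
* §2 **`locallyIntegrable_of_norm_comp_mk_le`** — if moreover `‖W (mk g)‖ ≤ w(↑g)` for all `g ∈ GL₂(F)` with `w` locally `dX`-integrable ON `{X | IsUnit X} ⊆ M₂(F)`
  (`dX` additive Haar), then `W` is locally `μ'`-integrable (★ (b) then ★ (c)) — the shape in which the `N = 2` non-elliptic weight file and the ASM of `hNE₂` consume T15.
[HarishChandra1970, Part I §1, Part V §6 Thm. 15, Part VII §3] [WeilBNT1967, Ch. II §5]
HONEST LABEL: HC_CM is proved only modulo the 7 printed citations (2 remaining named inputs: hLiu418 = stmt-HodgeConjecture-24832, h413 = stmt-HodgeConjecture-24833)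
until rung 0 closes; count-neutral helper.

## Mathlib ∕ tree search
Tree: ★ `K2E3HaarLocallyIntegrableTransport.{locallyIntegrable_of_locallyIntegrable_comp, locallyIntegrable_comp_coe}`, ★ 2A-2 `K2E3GL2SupercuspidalCharLocInt.eq_one_of_mem_glInt_of_mk_eq_one`,
★ `K2E3GL2ModCentre.{secondCountableTopology_gl2, locallyCompactSpace_gl2}`, ★ `isOpen_glInt`.
Mathlib: `QuotientGroup.continuous_mk`, `QuotientGroup.isOpenMap_coe`, `QuotientGroup.mk_surjective`, `LocallyIntegrable.mono`.
Dedup: `rg "locallyIntegrable.*comp_mk|comp_mk_le"` over Literature∕Summits — only the `Fin 3` twin ★ `K2E3GL3ModUniformizerLocIntTransfer`.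

## References
* [HarishChandra1970] Harish-Chandra (van Dijk), *Harmonic Analysis on Reductive p-adic Groups*, LNM 162 (1970), Part I §1, Part V §6, Part VII §3.
* [WeilBNT1967] A. Weil, *Basic Number Theory* (1967), Ch. II §5.
-/

set_option autoImplicit false
set_option linter.dupNamespace false

noncomputable section

open MeasureTheory MeasureTheory.Measure Set Function Topology Filter
open scoped NNReal ENNReal MatrixGroups WithZero Valued
open Literature.NumberTheory.GaloisRepresentations Literature.NumberTheory.GaloisRepresentations.IsNonarchimedeanLocalField
open Literature.NumberTheory.Automorphic
open Summit.HodgeConjecture.HodgeConjecture.Cruxes.H413.K2E3HaarLocallyIntegrableTransport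
open Summit.HodgeConjecture.HodgeConjecture.Cruxes.H413.K2E3GL2SupercuspidalCharLocInt (eq_one_of_mem_glInt_of_mk_eq_one)
open Summit.HodgeConjecture.HodgeConjecture.Cruxes.H413.K2E3GL2ModCentre

namespace Summit.HodgeConjecture.HodgeConjecture.Cruxes.H413.K2E3GL2ModUniformizerLocIntTransfer

variable {F : Type*} [Field F] [Valued F ℤᵐ⁰] [ValuativeRel F] [(Valued.v : Valuation F ℤᵐ⁰).Compatible] [IsNonarchimedeanLocalField F]

/-! ## §1  Local integrability on `G'` from the pull-back to `GL₂(F)` -/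

variable [MeasurableSpace (GL (Fin 2) F)] [BorelSpace (GL (Fin 2) F)]

/-- **§1 Local integrability on `G' = GL₂(F) ⧸ ϖ^ℤ·1` from local integrability of the pull-back to `GL₂(F)`** (★ (c) at `p = mk`, `V = GL₂(𝒪)`).
[cite: HarishChandra1970, Part I §1] [cite: WeilBNT1967, Ch. II §5] -/
theorem locallyIntegrable_of_locallyIntegrable_comp_mk {ϖ : F} (hϖ : Valued.v ϖ = WithZero.exp (-1 : ℤ)) (hϖ0 : ϖ ≠ 0)
    [((Subgroup.zpowers (Units.mk0 ϖ hϖ0)).map (Matrix.GeneralLinearGroup.scalar (Fin 2))).Normal]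
    [MeasurableSpace (GL (Fin 2) F ⧸ (Subgroup.zpowers (Units.mk0 ϖ hϖ0)).map (Matrix.GeneralLinearGroup.scalar (Fin 2)))]
    [BorelSpace (GL (Fin 2) F ⧸ (Subgroup.zpowers (Units.mk0 ϖ hϖ0)).map (Matrix.GeneralLinearGroup.scalar (Fin 2)))]
    (ρ : Measure (GL (Fin 2) F)) [ρ.IsHaarMeasure]
    (μ' : Measure (GL (Fin 2) F ⧸ (Subgroup.zpowers (Units.mk0 ϖ hϖ0)).map (Matrix.GeneralLinearGroup.scalar (Fin 2)))) [μ'.IsHaarMeasure]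
    {E : Type*} [NormedAddCommGroup E] {W : GL (Fin 2) F ⧸ (Subgroup.zpowers (Units.mk0 ϖ hϖ0)).map (Matrix.GeneralLinearGroup.scalar (Fin 2)) → E}
    (hWm : AEStronglyMeasurable W μ')
    (hW : LocallyIntegrable (fun g : GL (Fin 2) F => W (QuotientGroup.mk g)) ρ) :
    LocallyIntegrable W μ' := by
  haveI : IsTopologicalRing F := inferInstance
  haveI : T2Space F := (isLocalField F).toT2Space
  haveI : SecondCountableTopology (GL (Fin 2) F) := secondCountableTopology_gl2 F
  haveI : LocallyCompactSpace (GL (Fin 2) F) := locallyCompactSpace_gl2 F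
  exact locallyIntegrable_of_locallyIntegrable_comp
    (QuotientGroup.mk' ((Subgroup.zpowers (Units.mk0 ϖ hϖ0)).map (Matrix.GeneralLinearGroup.scalar (Fin 2))))
    QuotientGroup.continuous_mk QuotientGroup.isOpenMap_coe QuotientGroup.mk_surjective (glInt 2 F) (isOpen_glInt 2 F)
    (fun x hx h1 => eq_one_of_mem_glInt_of_mk_eq_one hϖ hϖ0 hx h1) ρ μ' hWm hW

variable [MeasurableSpace (Matrix (Fin 2) (Fin 2) F)] [BorelSpace (Matrix (Fin 2) (Fin 2) F)]

/-! ## §2  The T15 transfer as the non-elliptic weight file eats it -/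

/-- **§2 THE T15 TRANSFER AT `N = 2`**: `W : G' → E` a.e.-strongly measurable (`μ'` Haar on `G' = GL₂(F) ⧸ ϖ^ℤ·1`), `W ∘ mk` a.e.-strongly measurable (`ρ` Haar on
`GL₂(F)`), and `‖W (mk g)‖ ≤ w(↑g)` for every `g ∈ GL₂(F)` with `w` locally `dX`-integrable on `{X ∈ M₂(F) | IsUnit X}` ⟹ `W` is locally `μ'`-integrable (★ (b) then ★ (c)).
[cite: HarishChandra1970, Part V §6 Thm. 15, Part VII §3] [cite: WeilBNT1967, Ch. I §4, Ch. II §5] -/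
theorem locallyIntegrable_of_norm_comp_mk_le {ϖ : F} (hϖ : Valued.v ϖ = WithZero.exp (-1 : ℤ)) (hϖ0 : ϖ ≠ 0)
    [((Subgroup.zpowers (Units.mk0 ϖ hϖ0)).map (Matrix.GeneralLinearGroup.scalar (Fin 2))).Normal]
    [MeasurableSpace (GL (Fin 2) F ⧸ (Subgroup.zpowers (Units.mk0 ϖ hϖ0)).map (Matrix.GeneralLinearGroup.scalar (Fin 2)))]
    [BorelSpace (GL (Fin 2) F ⧸ (Subgroup.zpowers (Units.mk0 ϖ hϖ0)).map (Matrix.GeneralLinearGroup.scalar (Fin 2)))]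
    (dX : Measure (Matrix (Fin 2) (Fin 2) F)) [dX.IsAddHaarMeasure] (ρ : Measure (GL (Fin 2) F)) [ρ.IsHaarMeasure]
    (μ' : Measure (GL (Fin 2) F ⧸ (Subgroup.zpowers (Units.mk0 ϖ hϖ0)).map (Matrix.GeneralLinearGroup.scalar (Fin 2)))) [μ'.IsHaarMeasure]
    {w : Matrix (Fin 2) (Fin 2) F → ℝ} (hw : LocallyIntegrableOn w {X : Matrix (Fin 2) (Fin 2) F | IsUnit X} dX)
    {E : Type*} [NormedAddCommGroup E] {W : GL (Fin 2) F ⧸ (Subgroup.zpowers (Units.mk0 ϖ hϖ0)).map (Matrix.GeneralLinearGroup.scalar (Fin 2)) → E}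
    (hWm : AEStronglyMeasurable W μ') (hWm' : AEStronglyMeasurable (fun g : GL (Fin 2) F => W (QuotientGroup.mk g)) ρ)
    (hle : ∀ g : GL (Fin 2) F, ‖W (QuotientGroup.mk g)‖ ≤ w (g : Matrix (Fin 2) (Fin 2) F)) :
    LocallyIntegrable W μ' := by
  have hwgl : LocallyIntegrable (fun g : GL (Fin 2) F => w (g : Matrix (Fin 2) (Fin 2) F)) ρ := locallyIntegrable_comp_coe dX ρ hw
  have hcomp : LocallyIntegrable (fun g : GL (Fin 2) F => W (QuotientGroup.mk g)) ρ :=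
    hwgl.mono hWm' (Eventually.of_forall fun g => (hle g).trans (Real.le_norm_self _))
  exact locallyIntegrable_of_locallyIntegrable_comp_mk hϖ hϖ0 ρ μ' hWm hcomp

end Summit.HodgeConjecture.HodgeConjecture.Cruxes.H413.K2E3GL2ModUniformizerLocIntTransfer

end
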